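import Summits.QuantumFields.YangMills.Theorems.SwapVirialDeficitBlowUpRingPaths
import Summits.QuantumFields.YangMills.Theorems.SwapVirialDeficitBlowUpPointwiseParam
import Summits.QuantumFields.YangMills.Theorems.SwapVirialDeficitBlowUpPrincipalLimit
import Summits.QuantumFields.YangMills.Theorems.SwapVirialDeficitZeroModeSigmaFourSmallBallLimit
import Summits.QuantumFields.YangMills.Theorems.SwapVirialDeficitZeroModeSigmaFourSmallBallTaylor
import HarnessLib

/-!
# The massive-mode rung at fixed `L`, brick J5-ae: hypothesis (P) of the blow-up shell FOR THE RING EVENT `blowUpSet`, almost everywhere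
# (free-hands support of ⟨stmt-QuantumFields-24197⟩ `SwapVirialDeficit.SwapGluedStiffness`; consumes ✓`…BlowUpRingTaylor` (regularity along the blow-up), w2 g57's ✓`…BlowUpRingPaths` (`ae_nondegenerate`),
# w3 g64's ✓`…BlowUpPointwiseParam` (`blowUpLimit`, `ae_shell_hP`), w2 g57's ✓`…BlowUpScaling` (`blowUpPoint`, `blowUpSet`))

On the blow-up space `B = ℍ × (((ℍ×ℍ)×ℍ) × (Fol L → ℍ))` with `β = cone ⊗ (vol³ ⊗ vol^{Fol L})` and `g x t := chartDeficit L z χ (blowUpPoint t x)`: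
* §1 ★ `ae_offLevel` — `β`-a.e. point is OFF the unit levels of the side conditions (`‖x̄‖ ≠ 1`, `‖ȳ‖ ≠ 1`, `|z₀| ≠ 1`, `|y_f,0| ≠ 1`) (non-degeneracy at `t = 0`
  is w2 g57's ✓`ae_nondegenerate`);
* §2 ★ `hbd_of_offLevel` — the side conditions `S u` («dilated letters in the unit balls at scale √u») versus their limit `S₀`: eventually in ∕ eventually out
  (✓`dilate_ball_iff`, ✓`dilateIm_ball_iff`);
* §3 ★★★ `ae_hP_blowUpSet` — (hP) of ✓`BlowUp.smallBall_limit_real_of_blowUp_of_weight_ae` for `E r u := blowUpSet L z χ (√u) (r·u)`, with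
  `Dom₀ := S₀ ∩ {x | g x 0 = 0}` and `G := blowUpLimit g`; `measurable_blowUpLimit_chartDeficit`, `measurableSet_dom₀_chartDeficit` = (hG), (hDom).
* §4 ★★★★ `principal_smallBall_limit`, ★★★ `tendsto_swap_meanAction_fixedL`, ★★★ `swap_stiffness_fixedL` — THE MASSIVE-MODE RUNG AT FIXED `L`, UNCONDITIONAL:
  §3 in the principal sector (`z ≡ false`, `χ ≡ 1`) fed BY NAME into w2 g57's J6 frame ✓`principal_smallBall_limit_of_hP` ∕ `tendsto_meanAction_fixedL_of_hP` ∕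
  `swap_stiffness_fixedL_of_hP` (✓`…BlowUpPrincipalLimit`: (S) ✓`ringMeasure_swapDeficit_le_eq_scaling_rpow`, (D″) ✓`hD_blowUpSet`, floor ✓`swap_volume_floor`, shell
  ✓`smallBall_limit_real_of_blowUp_of_weight_ae`, consumer ✓`tendsto_meanAction_of_principalLimit`): for every `L ≥ 1`,
  `∃ v > 0, μ_L.real{F^S_0 ≤ u} / u^{9L⁴−1} → v` (`u → 0⁺`), `b·(log Z^S(L,·,2L))′(b) − 12bL⁴ → −(9L⁴ − 1)` (`b → ∞`), and the stiffness sandwich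
  `12bL⁴ − 9L⁴ + 1 − ε ≤ b·(log Z^S)′(b) ≤ 12bL⁴ − 9L⁴ + 3/2 − (1/2 − ε)` eventually.  (w2 g57 assembled the same chain in scratch 12:53Z; the three names of §4 are the
  by-name probes announced there.)
HONEST LABEL: a FIXED-`L` theorem (`b → ∞` at each fixed `L ≥ 1`) for a DRAFT line's plan-level rung; the crux ⟨24197⟩ `SwapGluedStiffness` is WINDOW-UNIFORM in `L`
(`L ≤ β^a`) and stays OPEN, as do ⟨24194⟩ ∕ ⟨24196⟩ ∕ ⟨24497⟩; no crux, route or summit is proved; the Yang–Mills mass gap is NOT proved; no summit is proved by a line.  Seat ym-line-fcl-p3 g45 (cell ym-idea-1, free hands; item of record ⟨24085⟩ aside, untouched), `--supports stmt-QuantumFields-24197`.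
THEOREMS ONLY (0 `def`, 0 `sorry`), standard axioms; the series' local `ℍ` instances.  References: [cite: tHooft1979]; [cite: Luscher1983, §2]; [folklore].
-/

set_option autoImplicit false

noncomputable section

open MeasureTheory Quaternion Set Filter Topology
open scoped Quaternion ENNReal BigOperators ContDiff
open Literature.MathematicalPhysics.QuantumLattice
open Literature.MathematicalPhysics.QuantumFieldTheory hiding SU2
open Summit.QuantumFields.YangMills.Theorems.SwapTwistDeficit.ToronLog

attribute [local instance] Literature.Analysis.FluidPDE.Tao2016.quatMeasurableSpace
  Literature.Analysis.FluidPDE.Tao2016.quatBorelSpace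
  Literature.MathematicalPhysics.QuantumLattice.secondCountableTopology_su2

namespace Summit.QuantumFields.YangMills.Theorems.SwapVirialDeficit.BlowUpRing

open Summit.QuantumFields.YangMills.Theorems.FemtoTransferGap
open Summit.QuantumFields.YangMills.Theorems.SwapVirialDeficit.ZeroModeGroup
open Summit.QuantumFields.YangMills.Theorems.SwapVirialDeficit.ZeroModeSigma
open Summit.QuantumFields.YangMills.Theorems.SwapVirialDeficit.BlowUp

variable {L : ℕ} [NeZero L]

/-! ## §1 Almost every blow-up point is non-degenerate and off the unit levels -/

/-- ★ `β`-a.e. blow-up point is off the unit levels of the side conditions. [folklore] -/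
theorem ae_offLevel :
    ∀ᵐ x : ℍ × (((ℍ × ℍ) × ℍ) × (Fol L → ℍ)) ∂(coneMeasure.prod ((volume : Measure ((ℍ × ℍ) × ℍ)).prod (Measure.pi fun _ : Fol L => (volume : Measure ℍ)))),
      ‖axPart x.2.1.1.1‖ ≠ 1 ∧ ‖axPart x.2.1.1.2‖ ≠ 1 ∧ ‖(x.2.1.2.re : ℍ)‖ ≠ 1 ∧ ∀ f, ‖((x.2.2 f).re : ℍ)‖ ≠ 1 := by
  haveI := isProbabilityMeasure_coneMeasure
  set πF : Measure (Fol L → ℍ) := Measure.pi fun _ : Fol L => (volume : Measure ℍ) with hπF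
  set V3 : Measure ((ℍ × ℍ) × ℍ) := (volume : Measure ((ℍ × ℍ) × ℍ)) with hV3
  have hV3' : V3 = ((volume : Measure ℍ).prod (volume : Measure ℍ)).prod (volume : Measure ℍ) := rfl
  -- one-letter null sets
  have hax1 : ∀ᵐ x : ℍ ∂(volume : Measure ℍ), ‖axPart x‖ ≠ 1 := by
    have h : (volume : Measure ℍ) {x : ℍ | dilNormSq 0 x = 1} = 0 := volume_normZero_eq_one_null
    have h' : ∀ᵐ x : ℍ ∂(volume : Measure ℍ), dilNormSq 0 x ≠ 1 := by rw [ae_iff]; simpa only [ne_eq, not_not] using h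
    filter_upwards [h'] with x hx h1
    apply hx
    have h2 : ‖axPart x‖ ^ 2 = x.re ^ 2 + x.imI ^ 2 := by rw [sq_norm_eq_sum_sq]; simp [axPart]
    rw [dilNormSq_zero, ← h2, h1, one_pow]
  have hre1 : ∀ᵐ z : ℍ ∂(volume : Measure ℍ), ‖(z.re : ℍ)‖ ≠ 1 := by
    have h : (volume : Measure ℍ) {z : ℍ | z.re ^ 2 = (fun _ : Fin 3 → ℝ => (1:ℝ)) ![z.imI, z.imJ, z.imK]} = 0 := volume_re_sq_eq_null measurable_const
    have h' : ∀ᵐ z : ℍ ∂(volume : Measure ℍ), z.re ^ 2 ≠ 1 := by rw [ae_iff]; simpa only [ne_eq, not_not] using h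
    filter_upwards [h'] with z hz h1
    apply hz
    rw [Quaternion.norm_coe, Real.norm_eq_abs] at h1
    nlinarith [sq_abs z.re, h1]
  -- the letters block
  have hW : ∀ᵐ w : (ℍ × ℍ) × ℍ ∂V3, ‖axPart w.1.1‖ ≠ 1 ∧ ‖axPart w.1.2‖ ≠ 1 ∧ ‖(w.2.re : ℍ)‖ ≠ 1 := by
    rw [hV3']
    have hQx : Measure.QuasiMeasurePreserving (fun w : (ℍ × ℍ) × ℍ => w.1.1) (((volume : Measure ℍ).prod (volume : Measure ℍ)).prod (volume : Measure ℍ)) volume :=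
      (Measure.quasiMeasurePreserving_fst (μ := (volume : Measure ℍ)) (ν := (volume : Measure ℍ))).comp
        (Measure.quasiMeasurePreserving_fst (μ := (volume : Measure ℍ).prod (volume : Measure ℍ)) (ν := (volume : Measure ℍ)))
    have hQy : Measure.QuasiMeasurePreserving (fun w : (ℍ × ℍ) × ℍ => w.1.2) (((volume : Measure ℍ).prod (volume : Measure ℍ)).prod (volume : Measure ℍ)) volume :=
      (Measure.quasiMeasurePreserving_snd (μ := (volume : Measure ℍ)) (ν := (volume : Measure ℍ))).comp
        (Measure.quasiMeasurePreserving_fst (μ := (volume : Measure ℍ).prod (volume : Measure ℍ)) (ν := (volume : Measure ℍ)))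
    have hQz : Measure.QuasiMeasurePreserving (fun w : (ℍ × ℍ) × ℍ => w.2) (((volume : Measure ℍ).prod (volume : Measure ℍ)).prod (volume : Measure ℍ)) volume :=
      Measure.quasiMeasurePreserving_snd (μ := (volume : Measure ℍ).prod (volume : Measure ℍ)) (ν := (volume : Measure ℍ))
    filter_upwards [hQx.ae hax1, hQy.ae hax1, hQz.ae hre1] with w d e f
    exact ⟨d, e, f⟩
  -- the followers block
  have hF : ∀ᵐ y : Fol L → ℍ ∂πF, ∀ f, ‖((y f).re : ℍ)‖ ≠ 1 := by
    rw [ae_all_iff]; intro f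
    exact (Measure.tendsto_eval_ae_ae (μ := fun _ : Fol L => (volume : Measure ℍ)) (i := f)).eventually hre1
  -- lift to the blow-up space
  have hB : ∀ᵐ x : ℍ × (((ℍ × ℍ) × ℍ) × (Fol L → ℍ)) ∂(coneMeasure.prod (V3.prod πF)),
      ‖axPart x.2.1.1.1‖ ≠ 1 ∧ ‖axPart x.2.1.1.2‖ ≠ 1 ∧ ‖(x.2.1.2.re : ℍ)‖ ≠ 1 :=
    (Measure.quasiMeasurePreserving_snd (μ := coneMeasure) (ν := V3.prod πF)).ae
      ((Measure.quasiMeasurePreserving_fst (μ := V3) (ν := πF)).ae hW)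
  have hC : ∀ᵐ x : ℍ × (((ℍ × ℍ) × ℍ) × (Fol L → ℍ)) ∂(coneMeasure.prod (V3.prod πF)), ∀ f, ‖((x.2.2 f).re : ℍ)‖ ≠ 1 :=
    (Measure.quasiMeasurePreserving_snd (μ := coneMeasure) (ν := V3.prod πF)).ae
      ((Measure.quasiMeasurePreserving_snd (μ := V3) (ν := πF)).ae hF)
  filter_upwards [hB, hC] with x b c
  exact ⟨b.1, b.2.1, b.2.2, c⟩

/-! ## §2 The side conditions: eventually in, or eventually out -/

/-- A limit letter strictly inside the unit ball stays inside after a small dilation: `‖x̄‖ < 1 ⟹ ∀ᶠ u → 0⁺, ‖x̄‖² + u·‖x⊥‖² < 1`. [folklore] -/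
theorem eventually_sq_add_mul_lt_one {p q : ℝ} (hp : p < 1) :
    ∀ᶠ u in 𝓝[>] (0 : ℝ), p + (Real.sqrt u) ^ 2 * q < 1 := by
  have hcont : Tendsto (fun u : ℝ => p + u * q) (𝓝 (0 : ℝ)) (𝓝 (p + 0 * q)) :=
    tendsto_const_nhds.add (tendsto_id.mul tendsto_const_nhds)
  rw [zero_mul, add_zero] at hcont
  have hev := hcont.eventually (Iio_mem_nhds hp)
  filter_upwards [nhdsWithin_le_nhds hev, self_mem_nhdsWithin] with u hu hu0
  have hu0' : (0 : ℝ) < u := hu0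
  rw [Real.sq_sqrt hu0'.le]
  exact hu

/-- ★ **The side conditions, eventually**: off the unit levels, a blow-up point lies in `S u = {dil3 √u w ∈ ball3 ∧ ∀ f, ‖dilateIm √u (y f)‖ < 1}` for all small
`u > 0` if it lies in the limit set `S₀ = {‖x̄‖ < 1 ∧ ‖ȳ‖ < 1 ∧ |z₀| < 1 ∧ ∀ f, |y_{f,0}| < 1}`, and in none of them otherwise. [folklore] -/
theorem hbd_of_offLevel {x : ℍ × (((ℍ × ℍ) × ℍ) × (Fol L → ℍ))}
    (h1 : ‖axPart x.2.1.1.1‖ ≠ 1) (h2 : ‖axPart x.2.1.1.2‖ ≠ 1) (h3 : ‖(x.2.1.2.re : ℍ)‖ ≠ 1) (h4 : ∀ f, ‖((x.2.2 f).re : ℍ)‖ ≠ 1) :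
    (x ∈ {x : ℍ × (((ℍ × ℍ) × ℍ) × (Fol L → ℍ)) | ‖axPart x.2.1.1.1‖ < 1 ∧ ‖axPart x.2.1.1.2‖ < 1 ∧ ‖(x.2.1.2.re : ℍ)‖ < 1 ∧ ∀ f, ‖((x.2.2 f).re : ℍ)‖ < 1} →
      ∀ᶠ u in 𝓝[>] (0 : ℝ), x ∈ {x : ℍ × (((ℍ × ℍ) × ℍ) × (Fol L → ℍ)) | dil3 (Real.sqrt u) x.2.1 ∈ ball3 ∧ ∀ f, ‖dilateIm (Real.sqrt u) (x.2.2 f)‖ < 1}) ∧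
    (x ∉ {x : ℍ × (((ℍ × ℍ) × ℍ) × (Fol L → ℍ)) | ‖axPart x.2.1.1.1‖ < 1 ∧ ‖axPart x.2.1.1.2‖ < 1 ∧ ‖(x.2.1.2.re : ℍ)‖ < 1 ∧ ∀ f, ‖((x.2.2 f).re : ℍ)‖ < 1} →
      ∀ᶠ u in 𝓝[>] (0 : ℝ), x ∉ {x : ℍ × (((ℍ × ℍ) × ℍ) × (Fol L → ℍ)) | dil3 (Real.sqrt u) x.2.1 ∈ ball3 ∧ ∀ f, ‖dilateIm (Real.sqrt u) (x.2.2 f)‖ < 1}) := by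
  constructor
  · rintro ⟨ha, hb, hc, hd⟩
    have ea := eventually_sq_add_mul_lt_one (q := ‖trPart x.2.1.1.1‖ ^ 2) (by nlinarith [norm_nonneg (axPart x.2.1.1.1)] : ‖axPart x.2.1.1.1‖ ^ 2 < 1)
    have eb := eventually_sq_add_mul_lt_one (q := ‖trPart x.2.1.1.2‖ ^ 2) (by nlinarith [norm_nonneg (axPart x.2.1.1.2)] : ‖axPart x.2.1.1.2‖ ^ 2 < 1)
    have ec := eventually_sq_add_mul_lt_one (q := ‖x.2.1.2.im‖ ^ 2) (by nlinarith [norm_nonneg (x.2.1.2.re : ℍ)] : ‖(x.2.1.2.re : ℍ)‖ ^ 2 < 1)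
    have ed : ∀ᶠ u in 𝓝[>] (0 : ℝ), ∀ f, ‖((x.2.2 f).re : ℍ)‖ ^ 2 + (Real.sqrt u) ^ 2 * ‖(x.2.2 f).im‖ ^ 2 < 1 := by
      rw [eventually_all]
      intro f
      exact eventually_sq_add_mul_lt_one (by nlinarith [norm_nonneg ((x.2.2 f).re : ℍ), hd f] : ‖((x.2.2 f).re : ℍ)‖ ^ 2 < 1)
    filter_upwards [ea, eb, ec, ed] with u hua hub huc hud
    refine ⟨?_, fun f => (dilateIm_ball_iff (Or.inl (hud f))).2 (hd f)⟩
    rw [mem_ball3_iff, dil3_apply]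
    exact ⟨⟨(dilate_ball_iff (Or.inl hua)).2 ha, (dilate_ball_iff (Or.inl hub)).2 hb⟩, (dilateIm_ball_iff (Or.inl huc)).2 hc⟩
  · intro hout
    refine Eventually.of_forall fun u hin => hout ?_
    obtain ⟨hball, hfol⟩ := hin
    rw [mem_ball3_iff, dil3_apply] at hball
    obtain ⟨⟨hxa, hya⟩, hza⟩ := hball
    -- each dilated letter in the ball forces its limit letter inside (off the unit level)
    have key1 : ∀ {v : ℍ} {s : ℝ}, ‖axPart v‖ ≠ 1 → ‖dilate s v‖ < 1 → ‖axPart v‖ < 1 := by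
      intro v s hv hlt
      by_contra hge
      have hge' : 1 ≤ ‖axPart v‖ ^ 2 := by nlinarith [not_lt.1 hge, norm_nonneg (axPart v)]
      exact absurd ((dilate_ball_iff (Or.inr hge')).1 hlt) hge
    have key2 : ∀ {v : ℍ} {s : ℝ}, ‖(v.re : ℍ)‖ ≠ 1 → ‖dilateIm s v‖ < 1 → ‖(v.re : ℍ)‖ < 1 := by
      intro v s hv hlt
      by_contra hge
      have hge' : 1 ≤ ‖(v.re : ℍ)‖ ^ 2 := by nlinarith [not_lt.1 hge, norm_nonneg (v.re : ℍ)]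
      exact absurd ((dilateIm_ball_iff (Or.inr hge')).1 hlt) hge
    exact ⟨key1 h1 hxa, key1 h2 hya, key2 h3 hza, fun f => key2 (h4 f) (hfol f)⟩

/-! ## §3 Hypothesis (P) for the ring event -/

/-- (hG): the blow-up limit functional of the ring deficit is measurable. [folklore] -/
theorem measurable_blowUpLimit_chartDeficit (z : Fin 3 → Bool) (χ : Site 3 L → SU2) :
    Measurable (blowUpLimit (fun (x : ℍ × (((ℍ × ℍ) × ℍ) × (Fol L → ℍ))) (t : ℝ) => chartDeficit L z χ (blowUpPoint (L := L) t x))) :=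
  measurable_blowUpLimit fun _ => (measurable_chartDeficit z χ).comp (measurable_blowUpPoint _)

/-- (hDom): the flat set `Dom₀ = S₀ ∩ {g · 0 = 0}` is measurable. [folklore] -/
theorem measurableSet_dom₀_chartDeficit (z : Fin 3 → Bool) (χ : Site 3 L → SU2) :
    MeasurableSet ({x : ℍ × (((ℍ × ℍ) × ℍ) × (Fol L → ℍ)) | ‖axPart x.2.1.1.1‖ < 1 ∧ ‖axPart x.2.1.1.2‖ < 1 ∧ ‖(x.2.1.2.re : ℍ)‖ < 1 ∧
        ∀ f, ‖((x.2.2 f).re : ℍ)‖ < 1} ∩ {x | chartDeficit L z χ (blowUpPoint (L := L) 0 x) = 0}) := by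
  refine measurableSet_dom₀ ?_ (g := fun (x : ℍ × (((ℍ × ℍ) × ℍ) × (Fol L → ℍ))) (t : ℝ) => chartDeficit L z χ (blowUpPoint (L := L) t x))
    (show Measurable (fun x : ℍ × (((ℍ × ℍ) × ℍ) × (Fol L → ℍ)) => chartDeficit L z χ (blowUpPoint (L := L) 0 x)) from
      (measurable_chartDeficit z χ).comp (measurable_blowUpPoint 0))
  have hax : Continuous (axPart : ℍ → ℍ) := continuous_axPart_trPart.1
  have hre : Continuous fun v : ℍ => ((v.re : ℝ) : ℍ) := Quaternion.continuous_coe.comp Quaternion.continuous_re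
  have m1 : MeasurableSet {x : ℍ × (((ℍ × ℍ) × ℍ) × (Fol L → ℍ)) | ‖axPart x.2.1.1.1‖ < 1} :=
    measurableSet_lt ((hax.norm.measurable).comp (measurable_fst.comp (measurable_fst.comp (measurable_fst.comp measurable_snd)))) measurable_const
  have m2 : MeasurableSet {x : ℍ × (((ℍ × ℍ) × ℍ) × (Fol L → ℍ)) | ‖axPart x.2.1.1.2‖ < 1} :=
    measurableSet_lt ((hax.norm.measurable).comp (measurable_snd.comp (measurable_fst.comp (measurable_fst.comp measurable_snd)))) measurable_const
  have m3 : MeasurableSet {x : ℍ × (((ℍ × ℍ) × ℍ) × (Fol L → ℍ)) | ‖(x.2.1.2.re : ℍ)‖ < 1} :=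
    measurableSet_lt ((hre.norm.measurable).comp (measurable_snd.comp (measurable_fst.comp measurable_snd))) measurable_const
  have m4 : MeasurableSet {x : ℍ × (((ℍ × ℍ) × ℍ) × (Fol L → ℍ)) | ∀ f, ‖((x.2.2 f).re : ℍ)‖ < 1} := by
    have e : {x : ℍ × (((ℍ × ℍ) × ℍ) × (Fol L → ℍ)) | ∀ f, ‖((x.2.2 f).re : ℍ)‖ < 1} = ⋂ f, {x | ‖((x.2.2 f).re : ℍ)‖ < 1} := by
      ext x; simp only [Set.mem_setOf_eq, Set.mem_iInter]
    rw [e]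
    exact MeasurableSet.iInter fun f =>
      measurableSet_lt ((hre.norm.measurable).comp ((measurable_pi_apply f).comp (measurable_snd.comp measurable_snd))) measurable_const
  have e : {x : ℍ × (((ℍ × ℍ) × ℍ) × (Fol L → ℍ)) | ‖axPart x.2.1.1.1‖ < 1 ∧ ‖axPart x.2.1.1.2‖ < 1 ∧ ‖(x.2.1.2.re : ℍ)‖ < 1 ∧ ∀ f, ‖((x.2.2 f).re : ℍ)‖ < 1} =
      {x | ‖axPart x.2.1.1.1‖ < 1} ∩ ({x | ‖axPart x.2.1.1.2‖ < 1} ∩ ({x | ‖(x.2.1.2.re : ℍ)‖ < 1} ∩ {x | ∀ f, ‖((x.2.2 f).re : ℍ)‖ < 1})) := by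
    ext x; simp only [Set.mem_setOf_eq, Set.mem_inter_iff]
  rw [e]
  exact m1.inter (m2.inter (m3.inter m4))

/-- ★★★ **HYPOTHESIS (P) OF THE BLOW-UP SHELL FOR THE RING EVENT.**  With `g x t := chartDeficit L z χ (blowUpPoint t x)`, `G := blowUpLimit g` and
`Dom₀ := S₀ ∩ {g · 0 = 0}`: for `β`-a.e. blow-up point and every `r > 0` off the level `G x = r`, EVENTUALLY as `u → 0⁺`,
`x ∈ blowUpSet L z χ (√u) (r·u) ↔ (x ∈ Dom₀ ∧ G x < r)`. [folklore] -/
theorem ae_hP_blowUpSet (z : Fin 3 → Bool) (χ : Site 3 L → SU2) :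
    ∀ᵐ x : ℍ × (((ℍ × ℍ) × ℍ) × (Fol L → ℍ)) ∂(coneMeasure.prod ((volume : Measure ((ℍ × ℍ) × ℍ)).prod (Measure.pi fun _ : Fol L => (volume : Measure ℍ)))),
      ∀ r : ℝ, 0 < r → blowUpLimit (fun (x : ℍ × (((ℍ × ℍ) × ℍ) × (Fol L → ℍ))) (t : ℝ) => chartDeficit L z χ (blowUpPoint (L := L) t x)) x ≠ r →
        ∀ᶠ u in 𝓝[>] (0 : ℝ), (x ∈ blowUpSet L z χ (Real.sqrt u) (r * u) ↔
          (x ∈ ({x : ℍ × (((ℍ × ℍ) × ℍ) × (Fol L → ℍ)) | ‖axPart x.2.1.1.1‖ < 1 ∧ ‖axPart x.2.1.1.2‖ < 1 ∧ ‖(x.2.1.2.re : ℍ)‖ < 1 ∧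
              ∀ f, ‖((x.2.2 f).re : ℍ)‖ < 1} ∩ {x | chartDeficit L z χ (blowUpPoint (L := L) 0 x) = 0}) ∧
            blowUpLimit (fun (x : ℍ × (((ℍ × ℍ) × ℍ) × (Fol L → ℍ))) (t : ℝ) => chartDeficit L z χ (blowUpPoint (L := L) t x)) x < r)) := by
  have h := ae_shell_hP (coneMeasure.prod ((volume : Measure ((ℍ × ℍ) × ℍ)).prod (Measure.pi fun _ : Fol L => (volume : Measure ℍ))))
    (S := fun u => {x : ℍ × (((ℍ × ℍ) × ℍ) × (Fol L → ℍ)) | dil3 (Real.sqrt u) x.2.1 ∈ ball3 ∧ ∀ f, ‖dilateIm (Real.sqrt u) (x.2.2 f)‖ < 1})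
    (S₀ := {x : ℍ × (((ℍ × ℍ) × ℍ) × (Fol L → ℍ)) | ‖axPart x.2.1.1.1‖ < 1 ∧ ‖axPart x.2.1.1.2‖ < 1 ∧ ‖(x.2.1.2.re : ℍ)‖ < 1 ∧ ∀ f, ‖((x.2.2 f).re : ℍ)‖ < 1})
    (g := fun (x : ℍ × (((ℍ × ℍ) × ℍ) × (Fol L → ℍ))) (t : ℝ) => chartDeficit L z χ (blowUpPoint (L := L) t x)) ?_ ?_
  · filter_upwards [h] with x hx r hr hGr
    filter_upwards [hx r hr hGr] with u hu
    have e : (x ∈ blowUpSet L z χ (Real.sqrt u) (r * u)) ↔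
        x ∈ {y : ℍ × (((ℍ × ℍ) × ℍ) × (Fol L → ℍ)) | y ∈ {x : ℍ × (((ℍ × ℍ) × ℍ) × (Fol L → ℍ)) | dil3 (Real.sqrt u) x.2.1 ∈ ball3 ∧
          ∀ f, ‖dilateIm (Real.sqrt u) (x.2.2 f)‖ < 1} ∧ chartDeficit L z χ (blowUpPoint (L := L) (Real.sqrt u) y) ≤ r * u} := by
      simp only [blowUpSet, Set.mem_setOf_eq, and_assoc]
    rw [e]
    exact hu
  · filter_upwards [ae_offLevel (L := L)] with x hx
    exact hbd_of_offLevel hx.1 hx.2.1 hx.2.2.1 hx.2.2.2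
  · filter_upwards [ae_nondegenerate (L := L)] with x hx
    exact hreg_chartDeficit_blowUpPoint z χ hx.1 hx.2.1 hx.2.2.1 hx.2.2.2.1 hx.2.2.2.2

/-! ## §4 The massive-mode rung at fixed `L`, unconditional -/

/-- ★★★★ **THE PRINCIPAL SMALL-BALL LIMIT OF THE σ-GLUED RING DEFICIT AT FIXED `L`** (the target of memo-24197-massive-mode-rung, §0): for every `L ≥ 1`
there is `v > 0` with `μ_L.real{F^S_0 ≤ u} / u^{9L⁴−1} → v` as `u → 0⁺` — §3 in the principal sector fed into w2 g57's ✓`principal_smallBall_limit_of_hP`.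
[cite: tHooft1979] [cite: Luscher1983, §2] -/
theorem principal_smallBall_limit (L : ℕ) [NeZero L] :
    ∃ v : ℝ, 0 < v ∧ Tendsto (fun u : ℝ => (VirialFluxGap.RingDeficit.ringMeasure L).real {P | SwapRing.swapRingDeficit L (fun _ => false) P ≤ u} / u ^ (9 * L ^ 4 - 1))
      (𝓝[>] (0 : ℝ)) (𝓝 v) :=
  principal_smallBall_limit_of_hP L (measurable_blowUpLimit_chartDeficit (fun _ => false) (fun _ => 1))
    (measurableSet_dom₀_chartDeficit (fun _ => false) (fun _ => 1)) (ae_hP_blowUpSet (fun _ => false) (fun _ => 1))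

/-- ★★★ **THE σ-GLUED MEAN ACTION AT FIXED `L`**: `b·(log Z^S(L,·,2L))′(b) − 12bL⁴ → −(9L⁴ − 1)` as `b → ∞`, for every `L ≥ 1` (unconditional;
✓`tendsto_meanAction_fixedL_of_hP`). [cite: tHooft1979] [cite: Luscher1983, §2] -/
theorem tendsto_swap_meanAction_fixedL (L : ℕ) [NeZero L] :
    Tendsto (fun b : ℝ => b * deriv (fun x : ℝ => Real.log (TT.twistTrace L x (2 * L))) b - 12 * b * (L : ℝ) ^ 4) atTop
      (𝓝 (-(9 * (L : ℝ) ^ 4 - 1))) :=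
  tendsto_meanAction_fixedL_of_hP L (measurable_blowUpLimit_chartDeficit (fun _ => false) (fun _ => 1))
    (measurableSet_dom₀_chartDeficit (fun _ => false) (fun _ => 1)) (ae_hP_blowUpSet (fun _ => false) (fun _ => 1))

/-- ★★★ **THE FIXED-`L` STIFFNESS SANDWICH OF THE σ-GLUED RING**: for every `L ≥ 1` and `ε > 0`, eventually in `b`,
`12bL⁴ − 9L⁴ + 1 − ε ≤ b·(log Z^S(L,·,2L))′(b) ≤ 12bL⁴ − 9L⁴ + 3/2 − (1/2 − ε)` (unconditional; ✓`swap_stiffness_fixedL_of_hP`).  This is the row of ⟨24197⟩ at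
each FIXED `L` with any `c < 1/2`; the crux itself asks for it UNIFORMLY on the window `L ≤ β^a` and is NOT proved here. [cite: tHooft1979] [cite: Luscher1983, §2] -/
theorem swap_stiffness_fixedL (L : ℕ) [NeZero L] {ε : ℝ} (hε : 0 < ε) :
    ∃ β₃ : ℝ, ∀ b : ℝ, β₃ ≤ b →
      b * deriv (fun x : ℝ => Real.log (TT.twistTrace L x (2 * L))) b ≤
          12 * b * (L : ℝ) ^ 4 - 9 * (L : ℝ) ^ 4 + 3 / 2 - (1 / 2 - ε) ∧
      12 * b * (L : ℝ) ^ 4 - 9 * (L : ℝ) ^ 4 + 1 - ε ≤ b * deriv (fun x : ℝ => Real.log (TT.twistTrace L x (2 * L))) b :=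
  swap_stiffness_fixedL_of_hP L (measurable_blowUpLimit_chartDeficit (fun _ => false) (fun _ => 1))
    (measurableSet_dom₀_chartDeficit (fun _ => false) (fun _ => 1)) (ae_hP_blowUpSet (fun _ => false) (fun _ => 1)) hε

end Summit.QuantumFields.YangMills.Theorems.SwapVirialDeficit.BlowUpRing

end
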